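import Summits.QuantumFields.GaugeBoot.BootstrapConvergence
import Summits.QuantumFields.GaugeBoot.ClassBStrongCouplingAllGroups
import HarnessLib

/-!
# The infinite-volume `SU(N)` bootstrap at strong coupling: one solution, and the truncations converge to it (gauge-boot, L1 supplement)

HONEST FRAMING (cell `pub-gaugeboot`, page 1 of every file): the venture produces certified bounds
on lattice expectations at stated coupling, gauge group, dimension and torus size; NOT a mass gap,
NOT a continuum limit, NOT a string tension; NOT Yang–Mills-summit-bearing (barriers
`FixedCouplingUltralocality`, `PerturbativeInvisibility`). Structural; it certifies no number
and says nothing about RATES of convergence.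

## Content

On `ℤ^d` the untruncated bootstrap (normalisation + square-positivity on the local polynomial
observables + the loop equations as linear identities, `BootstrapFunctionals.lean`) has exactly the
DLR states as solutions (`exists_dlr_of_bootstrap_suN`, `bootstrap_of_dlr_suN`). In the Dobrushin
strong-coupling window `6(d-1) N |β| < 1` the DLR state is unique
(`subsingleton_ymGibbsMeasures_allGroups`), hence:

* ★★★ `eq_dlr_of_bootstrap_suN_of_small` — `SU(N)` on `ℤ^d`, `6(d-1) N |β| < 1`: every solution of
  the untruncated bootstrap equals, on every polynomial observable, the expectation in THE DLR state
  (= the infinite-volume limit of the torus Wilson states); `existsUnique_bootstrap_value_suN_of_small`;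
* ★★★ `bootstrap_convergence_Zd_suN_of_small` — any truncation scheme eventually containing each
  polynomial: for every polynomial observable `P` and `ε > 0`, for some level every feasible value of
  `P` is within `ε` of its infinite-volume expectation — the INFINITE-VOLUME lattice bootstrap
  converges at strong coupling.

Outside the uniqueness window the truncations still converge to the SET of DLR values
(`bootstrap_convergence_dlr_suN`); whether that set is a point is the phase-structure question, not
addressed here.

References: P. Anderson, M. Kruczenski, Nucl. Phys. B 921 (2017) (infinite-volume bootstrap at
strong coupling vs. the strong-coupling expansion); V. Kazakov, Z. Zheng, arXiv:2203.11360;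
Dobrushin uniqueness (tree `subsingleton_ymGibbsMeasures_allGroups`). Folklore.
-/

noncomputable section

open MeasureTheory Filter Topology NormedSpace
open Literature.MathematicalPhysics.QuantumFieldTheory (LatticeRep)
open Literature.MathematicalPhysics.QuantumLattice

namespace Summit.QuantumFields.GaugeBoot

variable {d : ℕ}

/-- ★★★ **`SU(N)` on `ℤ^d` at strong coupling: the untruncated bootstrap has exactly one
solution.** For `6(d-1) N |β| < 1`, every linear functional which is normalised, square-positive on
the polynomial observables and satisfies the loop equations equals, on every polynomial observable,
the expectation in any (= the unique) DLR state `ν`. [folklore] -/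
theorem eq_dlr_of_bootstrap_suN_of_small (N : ℕ) {β : ℝ}
    (hβ : 6 * ((d - 1 : ℕ) : ℝ) * N * |β| < 1)
    {ν : Measure (LGConfig d (Matrix.specialUnitaryGroup (Fin N) ℂ))}
    (hν : ν ∈ ymGibbsMeasures (d := d) (fundamentalRep (Fin N)) β)
    {φ : C(LGConfig d (Matrix.specialUnitaryGroup (Fin N) ℂ), ℝ) →ₗ[ℝ] ℝ} (h1 : φ 1 = 1)
    (hpos : ∀ a ∈ polyAlgebra (ι := ZdEdge d) (fundamentalLatticeRep N), 0 ≤ φ (a * a))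
    (hφ : IsSDFunctional (fundamentalLatticeRep N) (suExp N)
      (fun e => wilsonBoundaryAction (fundamentalRep (Fin N)) {e}) β φ)
    {a : C(LGConfig d (Matrix.specialUnitaryGroup (Fin N) ℂ), ℝ)}
    (ha : a ∈ polyAlgebra (ι := ZdEdge d) (fundamentalLatticeRep N)) :
    φ a = ∫ U, a U ∂ν := by
  obtain ⟨μ, hμ, hφμ⟩ := exists_dlr_of_bootstrap_suN N β h1 hpos hφ
  rw [hφμ a ha, subsingleton_ymGibbsMeasures_allGroups (fundamentalRep (Fin N))
    (continuous_fundamentalRep _) hβ hμ hν]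

/-- ★★★ **Existence and uniqueness of the bootstrap value at strong coupling** (`SU(N)`, `ℤ^d`,
`6(d-1) N |β| < 1`): there is a DLR state `ν` (an infinite-volume limit of torus Wilson states) such
that EVERY untruncated bootstrap solution takes the value `∫ a dν` on every polynomial observable
`a`. [folklore] -/
theorem exists_dlr_forall_bootstrap_suN_of_small (N : ℕ) {β : ℝ}
    (hβ : 6 * ((d - 1 : ℕ) : ℝ) * N * |β| < 1) :
    ∃ ν ∈ ymGibbsMeasures (d := d) (fundamentalRep (Fin N)) β,
      ∀ φ : C(LGConfig d (Matrix.specialUnitaryGroup (Fin N) ℂ), ℝ) →ₗ[ℝ] ℝ, φ 1 = 1 →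
        (∀ a ∈ polyAlgebra (ι := ZdEdge d) (fundamentalLatticeRep N), 0 ≤ φ (a * a)) →
          IsSDFunctional (fundamentalLatticeRep N) (suExp N)
            (fun e => wilsonBoundaryAction (fundamentalRep (Fin N)) {e}) β φ →
            ∀ a ∈ polyAlgebra (ι := ZdEdge d) (fundamentalLatticeRep N), φ a = ∫ U, a U ∂ν := by
  obtain ⟨ν, hνlim⟩ := infiniteVolumeLimitPoints_nonempty_holds (d := d) (fundamentalRep (Fin N))
    (continuous_fundamentalRep _) β
  have hν := mem_ymGibbsMeasures_of_mem_infiniteVolumeLimitPoints_holds (fundamentalRep (Fin N))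
    (continuous_fundamentalRep _) hνlim
  exact ⟨ν, hν, fun φ h1 hpos hφ a ha => eq_dlr_of_bootstrap_suN_of_small N hβ hν h1 hpos hφ ha⟩

/-- ★★★ **Convergence of the infinite-volume truncated bootstrap at strong coupling.** `SU(N)` on
`ℤ^d`, `6(d-1) N |β| < 1`, `ν` the (unique) DLR state, any truncation scheme `V n` eventually
containing each polynomial observable: for every polynomial observable `P` and `ε > 0` there is a
level at which every feasible value of `P` is within `ε` of `∫ P dν`. [folklore] -/
theorem bootstrap_convergence_Zd_suN_of_small (N : ℕ) {β : ℝ}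
    (hβ : 6 * ((d - 1 : ℕ) : ℝ) * N * |β| < 1)
    {ν : Measure (LGConfig d (Matrix.specialUnitaryGroup (Fin N) ℂ))}
    (hν : ν ∈ ymGibbsMeasures (d := d) (fundamentalRep (Fin N)) β)
    (V : ℕ → Set C(LGConfig d (Matrix.specialUnitaryGroup (Fin N) ℂ), ℝ))
    (hex : ∀ a ∈ polyAlgebra (ι := ZdEdge d) (fundamentalLatticeRep N), ∀ᶠ n in atTop, a ∈ V n)
    {P : C(LGConfig d (Matrix.specialUnitaryGroup (Fin N) ℂ), ℝ)}
    (hP : P ∈ polyAlgebra (ι := ZdEdge d) (fundamentalLatticeRep N)) {ε : ℝ} (hε : 0 < ε) :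
    ∃ n, ∀ φ : C(LGConfig d (Matrix.specialUnitaryGroup (Fin N) ℂ), ℝ) →ₗ[ℝ] ℝ,
      IsBootstrapFeasible (fundamentalLatticeRep N) (suExp N)
          (fun e => wilsonBoundaryAction (fundamentalRep (Fin N)) {e}) β (V n) φ →
        |φ P - ∫ U, P U ∂ν| ≤ ε :=
  bootstrap_convergence_of_unique (fundamentalLatticeRep N) (suExp_add N)
    (X := fun X : SuGenerator N => (X : Matrix (Fin N) (Fin N) ℂ)) (rho_suExp N)
    (fun e => wilsonBoundaryAction_mem_polyFunctions (fundamentalLatticeRep N) {e}) V hex hP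
    (fun _ hψ => eq_dlr_of_bootstrap_suN_of_small N hβ hν hψ.1 hψ.2.1 hψ.2.2 hP) hε

/-- **The DLR expectation is feasible at every polynomial level** (`ℤ^d`, any `β`): the truncated
feasible sets contain the infinite-volume values, so the previous theorem says the truncated bounds
converge to them. [folklore] -/
theorem isBootstrapFeasible_dlr_suN (N : ℕ) (β : ℝ)
    {ν : Measure (LGConfig d (Matrix.specialUnitaryGroup (Fin N) ℂ))}
    (hν : ν ∈ ymGibbsMeasures (d := d) (fundamentalRep (Fin N)) β)
    {V : Set C(LGConfig d (Matrix.specialUnitaryGroup (Fin N) ℂ), ℝ)}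
    (hV : V ⊆ polyAlgebra (ι := ZdEdge d) (fundamentalLatticeRep N)) :
    haveI := hν.1
    IsBootstrapFeasible (fundamentalLatticeRep N) (suExp N)
      (fun e => wilsonBoundaryAction (fundamentalRep (Fin N)) {e}) β V (expectationFunctional ν) := by
  haveI := hν.1
  exact isBootstrapFeasible_expectationFunctional (fundamentalLatticeRep N) (suExp_add N)
    (X := fun X : SuGenerator N => (X : Matrix (Fin N) (Fin N) ℂ)) (rho_suExp N)
    (fun e => wilsonBoundaryAction_mem_polyFunctions (fundamentalLatticeRep N) {e}) ν
    ((isPolySchwingerDysonState_iff_mem_ymGibbsMeasures_suN N β ν).2 hν) hV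

end Summit.QuantumFields.GaugeBoot

end
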